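import Mathlib.Order.LiminfLimsup
import Mathlib.Topology.Instances.ENNReal.Lemmas
import Literature.MathematicalPhysics.QuantumManyBody.BoseEinsteinCondensation
import HarnessLib

/-!
# BECHardSphereReduction / HardCoreDominates — the transfer schema (stub 2a of line `birth`)

Crux `HardCoreDominates` (stmt-AtomisticToContinuum-11884) of route `BECHardSphereReduction`,
line `birth`: the coupling path `v_t = v + t·1_{Iic R}` (`t : ℝ≥0`, `t → ∞`) from a finite-range
pair potential `v` to the hard spheres `HS_R = ⊤·1_{Iic R}`.

This file proves the registered stub `stub_transferSchema` — the pure ORDER THEORY of the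
definition `condensateNumber w N L = ⨆_{δ>0} ⨅_{Ψ : energy w Ψ ≤ E₀(w) + δ} λ_max(γ_Ψ)` in the
complete lattice `ℝ≥0∞`: if, for every hard-sphere slack `δ > 0` and every occupation error
`η > 0`, eventually in `t` some slack `δ' > 0` lets every `δ'`-near-minimiser `Ψ` of `v_t` be
shadowed by a `δ`-near-minimiser `Φ` of `HS_R` with `λ_max(γ_Φ) ≤ λ_max(γ_Ψ) + η`, then
`condensateNumber HS_R N L ≤ liminf_{t → ∞} condensateNumber v_t N L`.

* `iInf_maxOccupation_tsub_le_condensateNumber` — one slack at a time: such a shadowing at slacks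
  `(δ, δ')` gives `I_{w₁}(δ) - η ≤ condensateNumber w₂ N L`, where `I_{w₁}(δ)` is the `δ`-level
  infimum of `λ_max` over near-minimisers of `w₁`;
* `stub_transferSchema` — fix `δ > 0`; for `η > 0` the bound `I(δ) - η ≤ condensateNumber v_t N L`
  holds eventually in `t`, hence `I(δ) - η ≤ liminf_t condensateNumber v_t N L`
  (`Filter.le_liminf_of_le`), let `η → 0` (`ENNReal.le_of_forall_pos_le_add`) and take `⨆_{δ>0}`.

No analysis is used here: the analytic input of the line (stubs 2b `stub_cutToHardCore` and 2c
`stub_maxOccupationStability`) is exactly the hypothesis; nothing about `v`, `R`, `N`, `L` is assumed.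
-/

noncomputable section

namespace Summit.AtomisticToContinuum.BoseEinsteinCondensation.Cruxes.HardCoreDominates.Birth

open Filter Literature.MathematicalPhysics.QuantumManyBody.BoseGas
open scoped ENNReal NNReal

/-- **Transfer of near-minimisers, one slack at a time.** If some slack `δ' > 0` lets every
`δ'`-near-minimiser `Ψ` of the potential `w₂` be shadowed by a `δ`-near-minimiser `Φ` of the
potential `w₁` with `λ_max(γ_Φ) ≤ λ_max(γ_Ψ) + η`, then the `δ`-level infimum of `λ_max` over the
near-minimisers of `w₁`, less `η` (truncated subtraction in `ℝ≥0∞`), bounds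
`condensateNumber w₂ N L` from below. [folklore] -/
theorem iInf_maxOccupation_tsub_le_condensateNumber {N : ℕ} {L : ℝ} (w₁ w₂ : ℝ → ℝ≥0∞)
    {δ δ' η : ℝ≥0∞} (hδ' : 0 < δ')
    (h : ∀ Ψ : TrialState N L, energy w₂ Ψ ≤ groundStateEnergy w₂ N L + δ' →
      ∃ Φ : TrialState N L, energy w₁ Φ ≤ groundStateEnergy w₁ N L + δ ∧
        maxOccupation N Φ.ψ ≤ maxOccupation N Ψ.ψ + η) :
    (⨅ (Φ : TrialState N L) (_ : energy w₁ Φ ≤ groundStateEnergy w₁ N L + δ),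
        maxOccupation N Φ.ψ) - η ≤ condensateNumber w₂ N L := by
  refine le_condensateNumber w₂ hδ' fun Ψ hΨ => ?_
  obtain ⟨Φ, hΦ, hocc⟩ := h Ψ hΨ
  exact tsub_le_iff_right.2 ((iInf_maxOccupation_le w₁ Φ hΦ).trans hocc)

/-- **Stub 2a — TransferSchema (pure order theory of `condensateNumber = ⨆ δ ⨅ near-minimisers`).**
If, for every hard-sphere slack `δ > 0` and every occupation error `η > 0`, eventually in the
coupling `t` some slack `δ' > 0` lets every `δ'`-near-minimiser `Ψ` of `v_t = v + t·1_{Iic R}` be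
shadowed by a `δ`-near-minimiser `Φ` of the hard spheres `HS_R = ⊤·1_{Iic R}` with
`λ_max(γ_Φ) ≤ λ_max(γ_Ψ) + η`, then `condensateNumber HS_R N L ≤ liminf_t condensateNumber v_t N L`.
Proof: for fixed `δ > 0` and `η > 0`, eventually `I(δ) - η ≤ condensateNumber v_t N L`
(`iInf_maxOccupation_tsub_le_condensateNumber`), so `I(δ) - η ≤ liminf`; let `η → 0` and take the
supremum over `δ`. [folklore] -/
theorem stub_transferSchema :
    ∀ (v : ℝ → ENNReal) (R : ℝ) (N : ℕ) (L : ℝ),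
      (∀ δ : ENNReal, 0 < δ → ∀ η : ENNReal, 0 < η → ∃ T : NNReal, ∀ t : NNReal, T ≤ t →
        ∃ δ' : ENNReal, 0 < δ' ∧
          ∀ Ψ : Literature.MathematicalPhysics.QuantumManyBody.BoseGas.TrialState N L,
            Literature.MathematicalPhysics.QuantumManyBody.BoseGas.energy
                (v + Set.indicator (Set.Iic R) (fun _ : ℝ => (t : ENNReal))) Ψ ≤
              Literature.MathematicalPhysics.QuantumManyBody.BoseGas.groundStateEnergy
                (v + Set.indicator (Set.Iic R) (fun _ : ℝ => (t : ENNReal))) N L + δ' →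
            ∃ Φ : Literature.MathematicalPhysics.QuantumManyBody.BoseGas.TrialState N L,
              Literature.MathematicalPhysics.QuantumManyBody.BoseGas.energy
                  (Set.indicator (Set.Iic R) (fun _ : ℝ => (⊤ : ENNReal))) Φ ≤
                Literature.MathematicalPhysics.QuantumManyBody.BoseGas.groundStateEnergy
                  (Set.indicator (Set.Iic R) (fun _ : ℝ => (⊤ : ENNReal))) N L + δ ∧
              Literature.MathematicalPhysics.QuantumManyBody.BoseGas.maxOccupation N Φ.ψ ≤
                Literature.MathematicalPhysics.QuantumManyBody.BoseGas.maxOccupation N Ψ.ψ + η) →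
      Literature.MathematicalPhysics.QuantumManyBody.BoseGas.condensateNumber
          (Set.indicator (Set.Iic R) (fun _ : ℝ => (⊤ : ENNReal))) N L ≤
        Filter.liminf (fun t : NNReal =>
          Literature.MathematicalPhysics.QuantumManyBody.BoseGas.condensateNumber
            (v + Set.indicator (Set.Iic R) (fun _ : ℝ => (t : ENNReal))) N L) Filter.atTop := by
  intro v R N L hH
  refine iSup₂_le fun δ hδ => ?_
  refine ENNReal.le_of_forall_pos_le_add fun ε hε _ => ?_
  obtain ⟨T, hT⟩ := hH δ hδ ε (ENNReal.coe_pos.2 hε)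
  refine tsub_le_iff_right.1 (le_liminf_of_le (h := Filter.eventually_atTop.2 ⟨T, fun t ht => ?_⟩))
  obtain ⟨δ', hδ', hΨ⟩ := hT t ht
  exact iInf_maxOccupation_tsub_le_condensateNumber _ _ hδ' hΨ

end Summit.AtomisticToContinuum.BoseEinsteinCondensation.Cruxes.HardCoreDominates.Birth

end
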